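import Literature.AlgebraicGeometry.HodgeTheory.TwoNodalFormBranches
import Literature.AlgebraicGeometry.HodgeTheory.DiagonalSymmetryEigenHodgeNumbers
import HarnessLib

/-!
# The two branches through a two-nodal form EXCHANGED by a diagonal symmetry: the symmetry swaps the
# branch functions of the unfolding `F_{u,v} = f₁ + u g + v h` (brick (P4a) of programme «PL2-MERIDIANS»)

Family `hodge`, layer `Literature/AlgebraicGeometry/HodgeTheory`; sequel of `TwoNodalFormBranches`. Theorems only.
Written by the prover seat `hodge-nonav-20241-p1` (g18, cell `hodge-nonav`) for the registry binder
hPL₂exch = `picardLefschetz_exchangedPair` (crux K1-B, stmt-HodgeConjecture-19716).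

SETTING. `f₁` of degree `d` with exactly two ordinary double points `[p₀], [p₁]`; a diagonal `a ∈ (ℂˣ)ⁿ⁺²`
stabilising `f₁` and `g` (`F(a • x) = F(x)`) and EXCHANGING the nodes (`a • p₁ ∝ p₀`, `a • p₀ ∝ p₁`); a third
form `h` of degree `d` which is an `a`-EIGENFORM, `h(a • x) = χ h(x)`, `χ ≠ 0`. Then the unfolding satisfies
`F_{ι(u,v)}(a • x) = F_{u,v}(x)` for `ι(u,v) := (u, χ⁻¹ v)`, so `z` is a singular point of `F_{u,v}` iff `a • z` is
one of `F_{ι(u,v)}`: the symmetry, read on the parameter plane as `ι` (which fixes the pencil line `v = 0`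
pointwise and commutes with `u`-translations), SWAPS the two local branches of the discriminant:
`φ₁(ι q) = 0 ↔ φ₀(q) = 0` and `φ₀(ι q) = 0 ↔ φ₁(q) = 0` near `0`.

* `aeval_diagonalSubst_unfolding` — `F_{ι q} ∘ (a • ·) = F_q` as polynomials;
* `exists_twoNodal_branches_symm` — `exists_twoNodal_branches` (all its clauses) PLUS the two swap
  equivalences for `ι(u,v) = (u, χ⁻¹ v)`; this is the INPUT, with the symmetric clause, of the topological
  brick (P2) of `littype-FH1-2` (the pencil circle around `f₁` decomposes as `[ℓ₀]·[ι∘ℓ₀] = [ι∘ℓ₀]·[ℓ₀]` for a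
  one-node meridian `ℓ₀`).

Honest scope: local structure of the discriminant only (no monodromy, no HC).

## References

* [VoisinHodgeII2003] C. Voisin, Hodge Theory and Complex Algebraic Geometry II, CUP 2003, §2.1.1 Lemma 2.7,
  Cor. 2.8, pp. 69–70; §2.3.1.
-/

noncomputable section

open MvPolynomial
open _root_.Topology _root_.Filter Set
open Literature.AlgebraicGeometry.Motives Literature.AlgebraicGeometry.Motives.UniversalHypersurface

namespace Literature.AlgebraicGeometry.HodgeTheory

namespace DiscriminantBranches

variable {n d : ℕ} {f₁ g h : MvPolynomial (Fin (n + 2)) ℂ} {p : Fin 2 → Fin (n + 2) → ℂ}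
  {a : Fin (n + 2) → ℂˣ} {χ : ℂ}

/-- **`F_{ι q}(a • x) = F_q(x)`**: for `a` stabilising `f₁, g` and `h(a • x) = χ h(x)`, the member over
`ι q = (q.1, χ⁻¹ q.2)` composed with `x ↦ a • x` is the member over `q`. [cite: VoisinHodgeII2003, §2.3.1] -/
theorem aeval_diagonalSubst_unfolding (ha₁ : a ∈ diagonalStabilizer f₁) (hag : a ∈ diagonalStabilizer g)
    (hχ : aeval (diagonalSubst a) h = χ • h) (hχ0 : χ ≠ 0) (q : ℂ × ℂ) :
    aeval (diagonalSubst a) (f₁ + q.1 • g + (χ⁻¹ * q.2) • h) = f₁ + q.1 • g + q.2 • h := by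
  rw [map_add, map_add, map_smul, map_smul, mem_diagonalStabilizer_iff.mp ha₁, mem_diagonalStabilizer_iff.mp hag,
    hχ, smul_smul, show χ⁻¹ * q.2 * χ = q.2 by field_simp]

/-- Singular points transfer under the symmetry: all partials of `F_q` vanish at `z` iff all partials of
`F_{ι q}` vanish at `a • z`. [cite: VoisinHodgeII2003, §2.3.1] -/
theorem forall_eval_pderiv_eq_zero_iff_smul (ha₁ : a ∈ diagonalStabilizer f₁) (hag : a ∈ diagonalStabilizer g)
    (hχ : aeval (diagonalSubst a) h = χ • h) (hχ0 : χ ≠ 0) (q : ℂ × ℂ) (z : Fin (n + 2) → ℂ) :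
    (∀ j, eval z (pderiv j (f₁ + q.1 • g + q.2 • h)) = 0) ↔
      ∀ j, eval (a • z) (pderiv j (f₁ + q.1 • g + (χ⁻¹ * q.2) • h)) = 0 := by
  have key : ∀ j, eval z (pderiv j (f₁ + q.1 • g + q.2 • h)) =
      (a j : ℂ) * eval (a • z) (pderiv j (f₁ + q.1 • g + (χ⁻¹ * q.2) • h)) := fun j => by
    rw [← aeval_diagonalSubst_unfolding ha₁ hag hχ hχ0 q, pderiv_aeval_diagonalSubst, smul_eval,
      eval_aeval_diagonalSubst]
  constructor
  · intro hz j
    have := hz j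
    rw [key j] at this
    exact (mul_eq_zero.1 this).resolve_left (Units.ne_zero (a j))
  · intro hz j
    rw [key j, hz j, mul_zero]

/-- **The two branches through a two-nodal form exchanged by a diagonal symmetry, with the swap.** Hypotheses
of `exists_twoNodal_branches` plus: `a` stabilises `f₁` and `g`, exchanges the nodes (`a • p₁ = t • p₀`,
`a • p₀ = t' • p₁`), and `h` is an `a`-eigenform with eigenvalue `χ ≠ 0`. Conclusion: the clauses of
`exists_twoNodal_branches` and, for `ι(u,v) = (u, χ⁻¹ v)`: `∀ q ∈ N, (φ₁(ι q) = 0 ↔ φ₀(q) = 0) ∧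
(φ₀(ι q) = 0 ↔ φ₁(q) = 0)`. [cite: VoisinHodgeII2003, §2.1.1 Lemma 2.7, Cor. 2.8 and pp. 69–70, §2.3.1] -/
theorem exists_twoNodal_branches_symm (hf₁ : f₁.IsHomogeneous d) (hg : g.IsHomogeneous d) (hh : h.IsHomogeneous d)
    (hnod : IsNodalFormWithNodes f₁ p) (hg0 : ∀ i, eval (p i) g ≠ 0)
    (ha₁ : a ∈ diagonalStabilizer f₁) (hag : a ∈ diagonalStabilizer g) (hχ : aeval (diagonalSubst a) h = χ • h)
    (hχ0 : χ ≠ 0) (h10 : ∃ t : ℂ, a • p 1 = t • p 0) (h01 : ∃ t : ℂ, a • p 0 = t • p 1) :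
    ∃ (φ : Fin 2 → ℂ × ℂ → ℂ) (z : Fin 2 → ℂ × ℂ → (Fin (n + 2) → ℂ)) (N : Set (ℂ × ℂ)),
      IsOpen N ∧ (0 : ℂ × ℂ) ∈ N ∧
      (∀ i, φ i 0 = 0) ∧
      (∀ i, HasStrictFDerivAt (φ i)
        (eval (p i) g • ContinuousLinearMap.fst ℂ ℂ ℂ + eval (p i) h • ContinuousLinearMap.snd ℂ ℂ ℂ) 0) ∧
      (∀ i, DifferentiableOn ℂ (φ i) N) ∧
      (∀ i, ContinuousAt (z i) 0 ∧ z i 0 = p i) ∧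
      (∀ q ∈ N, SmoothHypersurface.IsNonsingularForm ℂ (f₁ + q.1 • g + q.2 • h) ↔ (φ 0 q ≠ 0 ∧ φ 1 q ≠ 0)) ∧
      (∀ q ∈ N, ∀ i, φ i q = 0 → (∀ i', i' ≠ i → φ i' q ≠ 0) →
        IsNodalFormWithNodes (f₁ + q.1 • g + q.2 • h) ![z i q] ∧ eval (z i q) g ≠ 0) ∧
      (∀ q ∈ N, (φ 1 (q.1, χ⁻¹ * q.2) = 0 ↔ φ 0 q = 0) ∧ (φ 0 (q.1, χ⁻¹ * q.2) = 0 ↔ φ 1 q = 0)) := by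
  classical
  set a₁ := coeffsOf n d f₁ with ha₁def
  -- the affine parameter map `a(u,v) = a₁ + u·cg + v·ch` and the symmetry `ι` on the plane
  set L : ℂ × ℂ →L[ℂ] (DegIndex n d → ℂ) :=
    (ContinuousLinearMap.fst ℂ ℂ ℂ).smulRight (coeffsOf n d g) +
      (ContinuousLinearMap.snd ℂ ℂ ℂ).smulRight (coeffsOf n d h) with hL
  set A : ℂ × ℂ → (DegIndex n d → ℂ) := fun q => a₁ + L q with hA
  set ι : ℂ × ℂ → ℂ × ℂ := fun q => (q.1, χ⁻¹ * q.2) with hι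
  have hLq : ∀ q : ℂ × ℂ, L q = q.1 • coeffsOf n d g + q.2 • coeffsOf n d h := fun q => rfl
  have hA0 : A 0 = a₁ := by
    rw [hA]; dsimp only; rw [hLq]; simp
  have hι0 : ι 0 = 0 := by simp [hι]
  have hAc : Continuous A := continuous_const.add L.continuous
  have hιc : Continuous ι := by
    refine Continuous.prodMk continuous_fst (continuous_const.mul continuous_snd)
  have hAd : HasStrictFDerivAt A L 0 := L.hasStrictFDerivAt.const_add a₁
  have hform : ∀ q : ℂ × ℂ, formOfCoeffs (A q) = f₁ + q.1 • g + q.2 • h := fun q => by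
    rw [hA]; dsimp only
    rw [hLq, formOfCoeffs_add, formOfCoeffs_add, formOfCoeffs_smul, formOfCoeffs_smul,
      formOfCoeffs_coeffsOf n d hf₁, formOfCoeffs_coeffsOf n d hg, formOfCoeffs_coeffsOf n d hh, add_assoc]
  have hformι : ∀ q : ℂ × ℂ, formOfCoeffs (A (ι q)) = f₁ + q.1 • g + (χ⁻¹ * q.2) • h := fun q => by
    rw [hform]
  have hd : 1 ≤ d := by have := two_le_of_isOrdinaryDoublePointOf hf₁ (hnod.1 0); omega
  -- node charts
  have hj₀ : ∀ i, ∃ j, p i j ≠ 0 := fun i => exists_apply_ne_zero_of_isNodal hnod i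
  choose j₀ hj₀ using hj₀
  have C : ∀ i, NodeChart n d f₁ (p i) (j₀ i) := fun i =>
    (nonempty_nodeChart hf₁ (hnod.1 i) (hj₀ i)).some
  -- Step 1: product neighbourhoods `U i × V i` of `(a₁, p i)` normalising into `Ω i`
  have hUV : ∀ i, ∃ (U : Set (DegIndex n d → ℂ)) (V : Set (Fin (n + 2) → ℂ)), IsOpen U ∧ a₁ ∈ U ∧
      IsOpen V ∧ p i ∈ V ∧ ∀ b ∈ U, ∀ x ∈ V, x (j₀ i) ≠ 0 ∧
        (Sum.elim ((p i (j₀ i) / x (j₀ i)) • x) b : JVar n d → ℂ) ∈ (C i).Ω := by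
    intro i
    let G : (DegIndex n d → ℂ) × (Fin (n + 2) → ℂ) → (JVar n d → ℂ) := fun q =>
      Sum.elim ((p i (j₀ i) / q.2 (j₀ i)) • q.2) q.1
    have hG : ContinuousAt G (a₁, p i) := by
      refine continuousAt_pi.2 fun v => ?_
      rcases v with j | m
      · simp only [G, Sum.elim_inl, Pi.smul_apply, smul_eq_mul]
        refine ContinuousAt.mul (ContinuousAt.div continuousAt_const ?_ (hj₀ i)) ?_
        · exact ((continuous_apply (j₀ i)).comp continuous_snd).continuousAt
        · exact ((continuous_apply j).comp continuous_snd).continuousAt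
      · exact ((continuous_apply m).comp continuous_fst).continuousAt
    have hG0 : G (a₁, p i) = Sum.elim (p i) a₁ := by
      simp only [G, div_self (hj₀ i), one_smul]
    have h1 : G ⁻¹' (C i).Ω ∈ 𝓝 (a₁, p i) :=
      hG.preimage_mem_nhds (by rw [hG0]; exact (C i).isOpen_Ω.mem_nhds (C i).mem_Ω)
    have h2 : {q : (DegIndex n d → ℂ) × (Fin (n + 2) → ℂ) | q.2 (j₀ i) ≠ 0} ∈ 𝓝 (a₁, p i) :=
      (isOpen_ne_fun ((continuous_apply (j₀ i)).comp continuous_snd) continuous_const).mem_nhds (hj₀ i)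
    obtain ⟨U, hU, V, hV, hsub⟩ := mem_nhds_prod_iff.1 (Filter.inter_mem h2 h1)
    obtain ⟨U', hU'U, hU'o, haU'⟩ := mem_nhds_iff.1 hU
    obtain ⟨V', hV'V, hV'o, hpV'⟩ := mem_nhds_iff.1 hV
    refine ⟨U', V', hU'o, haU', hV'o, hpV', fun b hb x hx => ?_⟩
    have := hsub (Set.mk_mem_prod (hU'U hb) (hV'V hx))
    exact ⟨this.1, this.2⟩
  choose U V hUo haU hVo hpV hUV using hUV
  -- the criterion «a singular point scaling into `V i` forces `φ_i = 0`»
  have hcrit : ∀ i, ∀ b ∈ U i, ∀ (x : Fin (n + 2) → ℂ) (t : ℂ), t • x ∈ V i →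
      (∀ j, eval x (pderiv j (formOfCoeffs b)) = 0) → (C i).branchFun b = 0 := by
    intro i b hb x t htx hpart
    obtain ⟨hne, hΩ⟩ := hUV i b hb (t • x) htx
    set s : ℂ := p i (j₀ i) / (t • x) (j₀ i) * t with hs
    have hx : (p i (j₀ i) / (t • x) (j₀ i)) • (t • x) = s • x := by rw [smul_smul]
    rw [hx] at hΩ
    have hsj : (s • x) (j₀ i) = p i (j₀ i) := by
      have : (s • x) (j₀ i) = p i (j₀ i) / (t • x) (j₀ i) * (t • x) (j₀ i) := by
        simp only [hs, Pi.smul_apply, smul_eq_mul]; ring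
      rw [this, div_mul_cancel₀ _ hne]
    have hpart' : ∀ j, eval (s • x) (pderiv j (formOfCoeffs b)) = 0 := fun j => by
      rw [eval_smul_of_isHomogeneous (isHomogeneous_formOfCoeffs b).pderiv, hpart j, mul_zero]
    have hF' : eval (s • x) (formOfCoeffs b) = 0 := by
      rw [eval_smul_of_isHomogeneous (isHomogeneous_formOfCoeffs b),
        eval_eq_zero_of_forall_eval_pderiv_eq_zero (isHomogeneous_formOfCoeffs b) hd hpart, mul_zero]
    exact ((C i).branchFun_eq_zero_of_singular hΩ hsj hpart' hF').2
  -- the scalars of the exchange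
  obtain ⟨t₁₀, ht₁₀⟩ := h10
  obtain ⟨t₀₁, ht₀₁⟩ := h01
  have ht₁₀0 : t₁₀ ≠ 0 := by
    intro h0; rw [h0, zero_smul] at ht₁₀
    exact (hnod.1 1).ne_zero (by
      have := congrArg (fun z => a⁻¹ • z) ht₁₀
      simpa using this)
  have ht₀₁0 : t₀₁ ≠ 0 := by
    intro h0; rw [h0, zero_smul] at ht₀₁
    exact (hnod.1 0).ne_zero (by
      have := congrArg (fun z => a⁻¹ • z) ht₀₁
      simpa using this)
  -- eventualities in the coefficient space: branch cover, one-nodal members, `g ≠ 0`, and `U i`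
  obtain ⟨W, hWo, haW, hWT, hcover⟩ := exists_branchCover hf₁ hnod j₀ hj₀ C
  have hone := eventually_isNodalFormWithNodes_of_branch_only hf₁ hnod hj₀ C
  have hgne : ∀ᶠ b in 𝓝 a₁, ∀ i, eval ((C i).node b) g ≠ 0 := by
    refine eventually_all.2 fun i => ?_
    have hc : ContinuousAt (fun b => eval ((C i).node b) g) a₁ :=
      (continuous_eval g).continuousAt.comp (((C i).analyticOnNhd_node _ (C i).mem_T).continuousAt)
    exact hc.eventually_ne (by rw [(C i).node_base]; exact hg0 i)
  have hU' : ∀ᶠ b in 𝓝 a₁, ∀ i, b ∈ U i := eventually_all.2 fun i => (hUo i).mem_nhds (haU i)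
  obtain ⟨O, hOsub, hOo, haO⟩ := mem_nhds_iff.1 (Filter.inter_mem (hWo.mem_nhds haW) ((hone.and hgne).and hU'))
  -- eventualities on the parameter plane: `A q, A (ι q) ∈ O`, nodes close to `p i`
  have hAq : ∀ᶠ q in 𝓝 (0 : ℂ × ℂ), A q ∈ O := hAc.continuousAt.preimage_mem_nhds (by rw [hA0]; exact hOo.mem_nhds haO)
  have hAιq : ∀ᶠ q in 𝓝 (0 : ℂ × ℂ), A (ι q) ∈ O :=
    (hAc.continuousAt.comp (by rw [← hι0]; exact hιc.continuousAt)).preimage_mem_nhds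
      (by rw [Function.comp_apply, hι0, hA0]; exact hOo.mem_nhds haO)
  -- scalar identities for the exchanged nodes
  have hsm : ∀ (c : ℂ) (b : Fin (n + 2) → ℂˣ) (x : Fin (n + 2) → ℂ), b • (c • x) = c • (b • x) := by
    intro c b x; funext i; simp only [Pi.smul_apply, smul_apply_eq_mul, smul_eq_mul]; ring
  have hp1 : a⁻¹ • p 1 = t₀₁⁻¹ • p 0 := by
    have h := congrArg (fun x => t₀₁⁻¹ • (a⁻¹ • x)) ht₀₁
    simp only [inv_smul_smul] at h
    rw [hsm, smul_smul, inv_mul_cancel₀ ht₀₁0, one_smul] at h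
    exact h.symm
  have hp0 : a⁻¹ • p 0 = t₁₀⁻¹ • p 1 := by
    have h := congrArg (fun x => t₁₀⁻¹ • (a⁻¹ • x)) ht₁₀
    simp only [inv_smul_smul] at h
    rw [hsm, smul_smul, inv_mul_cancel₀ ht₁₀0, one_smul] at h
    exact h.symm
  -- the node maps read on the plane, and their transports by `a^{±1}`, stay in the chart neighbourhoods
  have hnodec : ∀ i, ContinuousAt (fun b => (C i).node b) a₁ := fun i =>
    ((C i).analyticOnNhd_node _ (C i).mem_T).continuousAt
  have hAι0 : A (ι 0) = a₁ := by rw [hι0, hA0]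
  have hAιc : ContinuousAt (fun q => A (ι q)) 0 :=
    ContinuousAt.comp_of_eq (g := A) (f := ι) hAc.continuousAt hιc.continuousAt hι0
  -- the node maps composed with `A` and `A ∘ ι` are continuous at `0`
  have hnA : ∀ i, ContinuousAt (fun q => (C i).node (A q)) 0 := fun i =>
    ContinuousAt.comp_of_eq (g := fun b => (C i).node b) (f := A) (hnodec i) hAc.continuousAt hA0
  have hnAι : ∀ i, ContinuousAt (fun q => (C i).node (A (ι q))) 0 := fun i =>
    ContinuousAt.comp_of_eq (g := fun b => (C i).node b) (f := fun q => A (ι q)) (hnodec i) hAιc hAι0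
  have hlim : ∀ (i' : Fin 2) (ν : ℂ × ℂ → Fin (n + 2) → ℂ), ContinuousAt ν 0 → ν 0 = p i' →
      ∀ᶠ q in 𝓝 (0 : ℂ × ℂ), ν q ∈ V i' := fun i' ν hν h0 =>
    hν.preimage_mem_nhds ((hVo i').mem_nhds (by rw [h0]; exact hpV i'))
  have hcs : ∀ (c : ℂ) (b : Fin (n + 2) → ℂˣ), Continuous fun x : Fin (n + 2) → ℂ => c • (b • x) := fun c b =>
    (continuous_const_smul c).comp (continuous_const_smul b)
  -- (1) `t₀₁⁻¹ • a • x₀(A q) → p₁`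
  have hν1 := hlim 1 (fun q => t₀₁⁻¹ • (a • (C 0).node (A q))) ((hcs _ _).continuousAt.comp (hnA 0))
    (by show t₀₁⁻¹ • (a • (C 0).node (A 0)) = p 1
        rw [hA0, (C 0).node_base, ht₀₁, smul_smul, inv_mul_cancel₀ ht₀₁0, one_smul])
  -- (2) `t₀₁ • a⁻¹ • x₁(A (ι q)) → p₀`
  have hν2 := hlim 0 (fun q => t₀₁ • (a⁻¹ • (C 1).node (A (ι q)))) ((hcs _ _).continuousAt.comp (hnAι 1))
    (by show t₀₁ • (a⁻¹ • (C 1).node (A (ι 0))) = p 0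
        rw [hAι0, (C 1).node_base, hp1, smul_smul, mul_inv_cancel₀ ht₀₁0, one_smul])
  -- (3) `t₁₀⁻¹ • a • x₁(A q) → p₀`
  have hν3 := hlim 0 (fun q => t₁₀⁻¹ • (a • (C 1).node (A q))) ((hcs _ _).continuousAt.comp (hnA 1))
    (by show t₁₀⁻¹ • (a • (C 1).node (A 0)) = p 0
        rw [hA0, (C 1).node_base, ht₁₀, smul_smul, inv_mul_cancel₀ ht₁₀0, one_smul])
  -- (4) `t₁₀ • a⁻¹ • x₀(A (ι q)) → p₁`
  have hν4 := hlim 1 (fun q => t₁₀ • (a⁻¹ • (C 0).node (A (ι q)))) ((hcs _ _).continuousAt.comp (hnAι 0))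
    (by show t₁₀ • (a⁻¹ • (C 0).node (A (ι 0))) = p 1
        rw [hAι0, (C 0).node_base, hp0, smul_smul, mul_inv_cancel₀ ht₁₀0, one_smul])
  -- eventualities on the parameter plane: `A q, A (ι q) ∈ O`
  have hAq : ∀ᶠ q in 𝓝 (0 : ℂ × ℂ), A q ∈ O :=
    hAc.continuousAt.preimage_mem_nhds (by rw [hA0]; exact hOo.mem_nhds haO)
  have hAιq : ∀ᶠ q in 𝓝 (0 : ℂ × ℂ), A (ι q) ∈ O := hAιc.preimage_mem_nhds (by rw [hAι0]; exact hOo.mem_nhds haO)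
  obtain ⟨N, hNsub, hNo, h0N⟩ := mem_nhds_iff.1
    ((hAq.and hAιq).and ((hν1.and hν2).and (hν3.and hν4)))
  -- partials at the node when a branch function vanishes
  have hpartials : ∀ i (b : DegIndex n d → ℂ), b ∈ O → (C i).branchFun b = 0 →
      ∀ j, eval ((C i).node b) (pderiv j (formOfCoeffs b)) = 0 := fun i b hb h0 j =>
    (C i).eval_node_pderiv_of_branchFun_eq_zero (hj₀ i) (hWT i (hOsub hb).1) h0 j
  refine ⟨fun i q => (C i).branchFun (A q), fun i q => (C i).node (A q), N, hNo, h0N,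
    fun i => ?_, fun i => ?_, fun i => ?_, fun i => ?_, fun q hq => ?_, fun q hq i hi hother => ?_, fun q hq => ?_⟩
  · -- `φᵢ(0) = 0`
    simp only [hA0]
    exact (C i).branchFun_base hf₁ (hnod.1 i)
  · -- strict differential at `0`
    have han : AnalyticAt ℂ (C i).branchFun a₁ := (C i).analyticOnNhd_branchFun _ (C i).mem_T
    have hstr : HasStrictFDerivAt (C i).branchFun (evalCoeffCLM n d (p i)) (A 0) := by
      rw [hA0]
      have h1 := han.hasStrictFDerivAt
      rwa [((C i).hasFDerivAt_branchFun hf₁ (hnod.1 i)).fderiv] at h1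
    have hcomp := hstr.comp (0 : ℂ × ℂ) hAd
    refine hcomp.congr_fderiv (ContinuousLinearMap.ext fun q => ?_)
    have hD : (eval (p i) g • ContinuousLinearMap.fst ℂ ℂ ℂ + eval (p i) h • ContinuousLinearMap.snd ℂ ℂ ℂ) q =
        eval (p i) g * q.1 + eval (p i) h * q.2 := rfl
    rw [hD, ContinuousLinearMap.comp_apply, hLq, map_add, map_smul, map_smul, evalCoeffCLM_coeffsOf hg,
      evalCoeffCLM_coeffsOf hh, smul_eq_mul, smul_eq_mul, mul_comm q.1, mul_comm q.2]
  · -- differentiable on `N`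
    intro q hq
    have hqT : A q ∈ (C i).T := hWT i (hOsub (hNsub hq).1.1).1
    have hAq' : DifferentiableAt ℂ A q := ((hasFDerivAt_const a₁ q).add L.hasFDerivAt).differentiableAt
    exact (((C i).differentiableOn_branchFun _ hqT).differentiableAt
      ((C i).isOpen_T.mem_nhds hqT)).comp_differentiableWithinAt q hAq'.differentiableWithinAt
  · -- the node maps
    exact ⟨hnA i, by simp only [hA0]; exact (C i).node_base⟩
  · -- nonsingular iff off both branches
    have hqW : A q ∈ W := (hOsub (hNsub hq).1.1).1
    have h1 := hcover (A q) hqW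
    rw [mem_singularCoeffs_iff, hform q] at h1
    constructor
    · intro hns
      have hno : ¬ ∃ i, (C i).branchFun (A q) = 0 := fun hex => (h1.2 hex) hns
      push Not at hno
      exact ⟨hno 0, hno 1⟩
    · rintro ⟨h0, h1'⟩
      by_contra hs
      obtain ⟨i, hi⟩ := h1.1 hs
      fin_cases i
      · exact h0 hi
      · exact h1' hi
  · -- one branch only: one-nodal, `g ≠ 0` at the node
    obtain ⟨-, ⟨hone_q, hg_q⟩, -⟩ := hOsub (hNsub hq).1.1
    rw [← hform q]
    exact ⟨hone_q i hi hother, hg_q i⟩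
  · -- the symmetry swaps the branches
    obtain ⟨⟨hq, hιq⟩, ⟨hq1, hq2⟩, ⟨hq3, hq4⟩⟩ := hNsub hq
    obtain ⟨-, -, hUq⟩ := hOsub hq
    obtain ⟨-, -, hUιq⟩ := hOsub hιq
    have htr := forall_eval_pderiv_eq_zero_iff_smul (f₁ := f₁) (g := g) (h := h) ha₁ hag hχ hχ0 q
    refine ⟨⟨fun h0 => ?_, fun h0 => ?_⟩, ⟨fun h0 => ?_, fun h0 => ?_⟩⟩
    · -- (2) `φ₁(ι q) = 0 ⟹ φ₀(q) = 0`
      have hw := hpartials 1 (A (ι q)) hιq h0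
      simp only [hformι] at hw
      have hz := (htr (a⁻¹ • (C 1).node (A (ι q)))).2 (by simpa only [smul_inv_smul] using hw)
      simp only [← hform q] at hz
      exact hcrit 0 (A q) (hUq 0) _ t₀₁ hq2 hz
    · -- (1) `φ₀(q) = 0 ⟹ φ₁(ι q) = 0`
      have hz := hpartials 0 (A q) hq h0
      simp only [hform q] at hz
      have hw := (htr ((C 0).node (A q))).1 hz
      simp only [← hformι q] at hw
      exact hcrit 1 (A (ι q)) (hUιq 1) _ t₀₁⁻¹ hq1 hw
    · -- (4) `φ₀(ι q) = 0 ⟹ φ₁(q) = 0`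
      have hw := hpartials 0 (A (ι q)) hιq h0
      simp only [hformι] at hw
      have hz := (htr (a⁻¹ • (C 0).node (A (ι q)))).2 (by simpa only [smul_inv_smul] using hw)
      simp only [← hform q] at hz
      exact hcrit 1 (A q) (hUq 1) _ t₁₀ hq4 hz
    · -- (3) `φ₁(q) = 0 ⟹ φ₀(ι q) = 0`
      have hz := hpartials 1 (A q) hq h0
      simp only [hform q] at hz
      have hw := (htr ((C 1).node (A q))).1 hz
      simp only [← hformι q] at hw
      exact hcrit 0 (A (ι q)) (hUιq 0) _ t₁₀⁻¹ hq3 hw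

end DiscriminantBranches

end Literature.AlgebraicGeometry.HodgeTheory

end
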